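import Summits.QuantumFields.BalabanUV.Beta.FP.PerfectObjectsT
import Literature.MathematicalPhysics.QuantumFieldTheory.Balaban1983to89.Beta.ResolventReflection

/-!
# `BalabanUV.Beta.FP.SymmetryK` — road «FP» for binder row D1, leaf N3(ii)-K: the KERNEL-SIDE symmetry binders of every K-generic
# reflection END — decay `hKd`, block covariance `hKs`, reflection invariance `hKr` — DISCHARGED AT THE PERFECT RESOLVENT `KPerf … m`
# BY INHERITANCE from the finite level (no explicit symbol needed): exact at every `j` for the (j, m)-resolvents `KTot`, closed under
# the constructed entrywise limit `limMKerOf` (block covariance UNCONDITIONALLY; reflection invariance and decay for ENTRYWISE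
# CONVERGENT families = X1m-K's output, never assumed away)

HONEST FRAMING (cell contract, verbatim): «discharging `BetaPertH` makes Bałaban's UV stability UNCONDITIONAL — a real constructive-QFT
result; it is NOT the continuum limit and NOT the Clay problem.»  THIS MODULE DISCHARGES NOTHING of the wall: it composes LANDED theorems BY
NAME — an5's `ResolventReflection.refK_KInv` / `refK_dec` / `Φ` (the packed one-shot resolvent is reflection-invariant; reflection commutes
with block-contour decimation), `OneStepResolventKernel.shiftK_KInv` / `decays_KInv`, `OneStepKernelFamily.shiftK_dec` / `decays_dec'`,
`FP.PerfectObjects.KTot` (p207092), `FP.PerfectObjectsT.KPerf` (p207437), `HessKerDressedLimit.limMKerOf_eq_of_tendsto` — with [folklore]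
closure facts about `limMKerOf` (= `limUnder atTop` entry by entry).  Skeleton `HOME/beta/skeletons/D1-b2b-balaban-beta-d1-p3.md` §3 N3
(«(ii) EQUIVARIANCE of the unsliced perfect data under the hyperoctahedral group»); claim table `HOME/b2b-balaban-beta-d1-p3/LEAVES-FP.md`
row N3(ii)–(iv), sub-row N3(ii)-K (unit `b2b-balaban-beta-d1-formalise-leaf-06`).  The JET sides (N3(ii)-S/W: covariance of the perfect
stencils / tables), the Ward side N3(iii) and the slice independence N3(i) are NOT touched; §5 only records the generic sockets by which
jet covariances pass to `limStOf` / `limTabOf`.  NOT BetaPertH, NOT continuum, NOT Clay.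

ABSOLUTE RULE (cell, verbatim): «No internally-minted statement may enter as a cited fact. Every hypothesis is either kernel-proved in this
package or a verbatim quotation of a PUBLISHED theorem with page reference.»  Nothing is cited; no `def … : Prop`; no binder instantiated at a
value; every hypothesis below is a displayed convergence / covariance SHAPE on abstract families or on the cell's typed objects.

CONTENT (all [folklore] / [our object]).
* §1 FINITE LEVEL, EXACT (every `d`, `Lc ≥ 1`, `j`, `m`): **`refK_KTot`** `refK (Φ (Lc^m) α) (KTot (Lc^(j+m)) (Lc^j)) = KTot (Lc^(j+m)) (Lc^j)`
  (the (j, m)-resolvent is invariant under the reflection leg map AT BLOCKING `Lc^m` of the step-`j` lattice; `m = 1` is an5's `refK_KInvStep`),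
  **`shiftK_KTot`** (block covariance under the `Lc^m`-translations of the step-`j` lattice), `decays_KTot`; the `unitK`-rescaled forms
  (`refK_scaleK`/`refK_unitK`/`shiftK_unitK`: leg-type-constant units commute with both relabellings).
* §2 CLOSURE UNDER THE CONSTRUCTED LIMIT: `shiftK_limMKerOf` (UNCONDITIONAL — a re-indexing, definitional), `limMKerOf_refK_of_tendsto` /
  `refK_limMKerOf_of_exists_tendsto` / `refK_limMKerOf_of_invariant` (entrywise CONVERGENT families: the sign `s_a s_b` of `refK` does not pass
  through a junk `limUnder`), `limMKerOf_smul_of_exists_tendsto`, `limMKerOf_add_of_exists_tendsto`, `decays_limMKerOf_of_tendsto` (a `j`-uniform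
  `Decays` bound passes to the limit of a convergent family, SAME constant and rate — no all-scales data needed), and the currency bridges
  `exists_tendsto_of_decays` / `exists_tendsto_of_decays_rate`.
* §3 THE PERFECT RESOLVENT: **`shiftK_KPerf`** (0 hypotheses), **`refK_KPerf`** / **`decays_KPerf`** under
  `hconv : ∀ x y a b, ∃ L, Tendsto (j ↦ unitK (sf j) (sm j) (KTot (Lc^(j+m)) (Lc^j)) x y a b) atTop (𝓝 L)` (X1m-K; = the hypothesis shape of
  `FP.StationarityK.dec_KPerf_succ`), `Decays`-currency corollaries, and the package **`kernelSide_KPerf`** = the triple `(hKd, hKs, hKr)` VERBATIM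
  as consumed by `ResolventReflection.axisReflectionCovariant_flipK_hessKer`, `ChartConjugationEnd.…_conj/_conjT`, `ChartConjugationRelativeEnd.…_conj_rel`
  at `K := KPerf Lc sf sm m`, `N := Lc^m`.
* §4 INSTANCE **`axisReflectionCovariant_flipK_hessKer_KPerf`**: for ANY jet datum `J : JetData d (Lc^m)` with the four covariances (St♭)(Wt)(Sr)(Wr),
  `AxisReflectionCovariant (flipK (hessKer (KPerf …) (vertexOfK (KPerf …) (Lc^m) J.S) J.W))` — the UNDRESSED perfect one-loop kernel of blocking `Lc^m`.
  (The axially dressed `FP.PerfectObjectsT.TPerfOf` needs the rooted/centred dressing of an2's `AxialDressingRootedBm*` — not here.)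
* §5 GENERIC JET-FAMILY SOCKETS (for the N3(ii)-S/W seats; abstract families, nothing about Bałaban's jets asserted): block translation (St♭)/(Wt)
  passes to `limStOf`/`limTabOf` UNCONDITIONALLY (`translate_limStOf`, `translate_limTabOf`), reflection covariance (Sr)/(Wr) under entrywise
  convergence (`reflect_limStOf`, `reflect_limTabOf`), and all four survive the change of units `unitS`/`unitW` (`unitS_translate`, `unitW_translate`,
  `unitS_reflect`, `unitW_reflect`). -/

namespace Summit.QuantumFields.BalabanUV.Beta.FP.SymmetryK

open Filter Topology Finset
open scoped BigOperators
open Literature.MathematicalPhysics.QuantumFieldTheory.Balaban1983to89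
open Literature.MathematicalPhysics.QuantumFieldTheory.Balaban1983to89.Beta
open ExpKernelCalculus (MKer Decays shiftK hessKer)
open HessKerRate (scaleK scaleK_apply)
open RateCertificate (CauchyRate)
open PolarizationSign (reflSign AxisReflectionCovariant)
open KernelReflection (LegMap refK refK_apply)
open ResolventReflection (Φ bref refK_KInv refK_dec axisReflectionCovariant_flipK_hessKer)
open OneStepResolventKernel (Fib KInv decays_KInv shiftK_KInv JetData)
open OneStepKernelFamily (dec KInvStep decays_dec' shiftK_dec vertexOfK flipK)
open HessKerDressedLimit (limMKerOf limStOf limTabOf limMKerOf_apply limStOf_apply limTabOf_apply limMKerOf_eq_of_tendsto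
  tendsto_limMKerOf_of_decays tendsto_of_decays_rate mker_sub_apply)
open Summit.QuantumFields.BalabanUV.Beta.HessKerDressedUnits (legScale unitK unitK_apply counitK counitK_apply unitS unitW)
open Summit.QuantumFields.BalabanUV.Beta.FP.PerfectObjects (KTot KTot_def)
open Summit.QuantumFields.BalabanUV.Beta.FP.PerfectObjectsT (KPerf)

noncomputable section
/-! ## §1 Finite level: the (j, m)-resolvents are reflection-invariant, block-covariant and decaying — exactly, every `j` -/

section Finite

variable {d : ℕ} {Lc : ℕ} [NeZero Lc]

/-- [our object] **THE (j, m)-RESOLVENT IS REFLECTION-INVARIANT** under the reflection leg map of axis `α` AT BLOCKING `Lc^m` (field legs by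
`bref`, multiplier legs by `mref (Lc^m)` — the multiplier legs of `KTot (Lc^(j+m)) (Lc^j)` live at the `Lc^m`-coarse points of the step-`j`
lattice): `refK (Φ (Lc^m) α) (KTot (Lc^(j+m)) (Lc^j)) = KTot (Lc^(j+m)) (Lc^j)`.  Proof: `refK_dec` moves the reflection through the
`Lc^j`-decimation onto the fine lattice at blocking `Lc^j · Lc^m = Lc^(j+m)`, where `refK_KInv` applies.  (`m = 1`: an5's `refK_KInvStep`.) -/
theorem refK_KTot (j m : ℕ) (α : Fin (d + 1)) :
    refK (Φ (d := d) (Lc ^ m) α) (KTot (d := d) (Lc ^ (j + m)) (Lc ^ j)) = KTot (Lc ^ (j + m)) (Lc ^ j) := by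
  rw [KTot_def, refK_dec, ← pow_add, refK_KInv]

/-- [our object] **BLOCK COVARIANCE OF THE (j, m)-RESOLVENT** under the `Lc^m`-translations of the step-`j` lattice
(`shiftK_dec` + `shiftK_KInv` at blocking `Lc^(j+m)`). -/
theorem shiftK_KTot (j m : ℕ) (t : Fin (d + 1) → ℤ) :
    shiftK (-(((Lc ^ m : ℕ) : ℤ) • t)) (KTot (d := d) (Lc ^ (j + m)) (Lc ^ j)) = KTot (Lc ^ (j + m)) (Lc ^ j) := by
  rw [KTot_def, shiftK_dec]
  have h : ((Lc ^ j : ℕ) : ℤ) • (-(((Lc ^ m : ℕ) : ℤ) • t)) = -(((Lc ^ (j + m) : ℕ) : ℤ) • t) := by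
    rw [smul_neg, smul_smul, show ((Lc ^ j : ℕ) : ℤ) * ((Lc ^ m : ℕ) : ℤ) = ((Lc ^ (j + m) : ℕ) : ℤ) by push_cast; ring]
  rw [h, shiftK_KInv]

/-- [our object] The (j, m)-resolvent decays exponentially (per `Lc`, `j`, `m`; `decays_dec'` ∘ `decays_KInv`). -/
theorem decays_KTot (j m : ℕ) : ∃ δ C : ℝ, 0 < δ ∧ 0 ≤ C ∧ Decays (KTot (d := d) (Lc ^ (j + m)) (Lc ^ j)) C δ := by
  rw [KTot_def]
  exact decays_dec' (decays_KInv (N := Lc ^ (j + m)) (d := d)) (Nat.one_le_iff_ne_zero.2 (pow_ne_zero _ (NeZero.ne Lc)))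

/-- [folklore] A leg relabelling commutes with leg-type rescalings (the relabelling keeps the leg types). -/
theorem refK_scaleK (Ψ : LegMap (d + 1) (Fib d)) (u v : Fib d → ℝ) (K : MKer (d + 1) (Fib d)) :
    refK Ψ (scaleK u v K) = scaleK u v (refK Ψ K) := by
  funext x y a b
  simp only [refK_apply, scaleK_apply]
  ring

/-- [folklore] A leg relabelling commutes with the change of units `unitK`. -/
theorem refK_unitK (Ψ : LegMap (d + 1) (Fib d)) (sf sm : ℝ) (K : MKer (d + 1) (Fib d)) :
    refK Ψ (unitK sf sm K) = unitK sf sm (refK Ψ K) := by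
  funext x y a b
  simp only [refK_apply, unitK_apply]
  ring

/-- [folklore] Translations commute with the change of units `unitK` (definitional). -/
theorem shiftK_unitK (v : Fin (d + 1) → ℤ) (sf sm : ℝ) (K : MKer (d + 1) (Fib d)) :
    shiftK v (unitK sf sm K) = unitK sf sm (shiftK v K) := rfl
/-- [our object] The unit-rescaled (j, m)-resolvent is reflection-invariant at blocking `Lc^m`, any units. -/
theorem refK_unitK_KTot (j m : ℕ) (sf sm : ℝ) (α : Fin (d + 1)) :
    refK (Φ (d := d) (Lc ^ m) α) (unitK sf sm (KTot (d := d) (Lc ^ (j + m)) (Lc ^ j))) = unitK sf sm (KTot (Lc ^ (j + m)) (Lc ^ j)) := by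
  rw [refK_unitK, refK_KTot]

/-- [our object] The unit-rescaled (j, m)-resolvent is block-covariant at blocking `Lc^m`, any units. -/
theorem shiftK_unitK_KTot (j m : ℕ) (sf sm : ℝ) (t : Fin (d + 1) → ℤ) :
    shiftK (-(((Lc ^ m : ℕ) : ℤ) • t)) (unitK sf sm (KTot (d := d) (Lc ^ (j + m)) (Lc ^ j))) = unitK sf sm (KTot (Lc ^ (j + m)) (Lc ^ j)) := by
  rw [shiftK_unitK, shiftK_KTot]

end Finite

/-! ## §2 Closure of the three properties under the constructed entrywise limit -/

section Closure

variable {D : ℕ} {F : Type*}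

/-- [folklore] **TRANSLATIONS COMMUTE WITH THE CONSTRUCTED LIMIT — UNCONDITIONALLY** (a re-indexing of entries; definitional). -/
theorem shiftK_limMKerOf (v : Fin D → ℤ) (K : ℕ → MKer D F) : shiftK v (limMKerOf K) = limMKerOf (fun j => shiftK v (K j)) := rfl

/-- [folklore] Hence a family invariant under a translation has an invariant constructed limit — no convergence needed. -/
theorem shiftK_limMKerOf_of_invariant {v : Fin D → ℤ} {K : ℕ → MKer D F} (h : ∀ j, shiftK v (K j) = K j) :
    shiftK v (limMKerOf K) = limMKerOf K := by
  rw [shiftK_limMKerOf]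
  exact congrArg limMKerOf (funext h)

/-- [folklore] Every entry of a family with convergent entries converges to the corresponding entry of the constructed limit. -/
theorem tendsto_limMKerOf_of_exists {K : ℕ → MKer D F} (h : ∀ x y a b, ∃ L : ℝ, Tendsto (fun j => K j x y a b) atTop (𝓝 L))
    (x y : Fin D → ℤ) (a b : F) : Tendsto (fun j => K j x y a b) atTop (𝓝 (limMKerOf K x y a b)) := by
  rw [limMKerOf_apply]
  exact tendsto_nhds_limUnder (h x y a b)

/-- [folklore] **A LEG RELABELLING IS ENTRYWISE CONTINUOUS**: the constructed limit of the relabelled CONVERGENT family is the relabelled limit. -/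
theorem limMKerOf_refK_of_tendsto (Ψ : LegMap D F) {K : ℕ → MKer D F} {Kinf : MKer D F}
    (h : ∀ x y a b, Tendsto (fun j => K j x y a b) atTop (𝓝 (Kinf x y a b))) :
    limMKerOf (fun j => refK Ψ (K j)) = refK Ψ Kinf :=
  limMKerOf_eq_of_tendsto fun x y a b => by
    simp only [refK_apply]
    exact (h _ _ a b).const_mul _

/-- [folklore] **`refK` COMMUTES WITH THE CONSTRUCTED LIMIT OF A CONVERGENT FAMILY.**  (Without convergence the constructed limit is a junk value
entry by entry and the sign `s_a s_b = −1` entries fail — the hypothesis is exactly X1m's output.) -/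
theorem refK_limMKerOf_of_exists_tendsto (Ψ : LegMap D F) {K : ℕ → MKer D F}
    (h : ∀ x y a b, ∃ L : ℝ, Tendsto (fun j => K j x y a b) atTop (𝓝 L)) :
    refK Ψ (limMKerOf K) = limMKerOf (fun j => refK Ψ (K j)) :=
  (limMKerOf_refK_of_tendsto Ψ (tendsto_limMKerOf_of_exists h)).symm

/-- [folklore] **CLOSURE OF REFLECTION INVARIANCE**: an entrywise convergent family of `Ψ`-invariant kernels has a `Ψ`-invariant constructed limit. -/
theorem refK_limMKerOf_of_invariant (Ψ : LegMap D F) {K : ℕ → MKer D F}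
    (h : ∀ x y a b, ∃ L : ℝ, Tendsto (fun j => K j x y a b) atTop (𝓝 L)) (hK : ∀ j, refK Ψ (K j) = K j) :
    refK Ψ (limMKerOf K) = limMKerOf K := by
  rw [refK_limMKerOf_of_exists_tendsto Ψ h]
  exact congrArg limMKerOf (funext hK)

/-- [folklore] Constant scalars pull out of the constructed limit of a convergent family. -/
theorem limMKerOf_smul_of_exists_tendsto (c : ℝ) {K : ℕ → MKer D F} (h : ∀ x y a b, ∃ L : ℝ, Tendsto (fun j => K j x y a b) atTop (𝓝 L)) :
    limMKerOf (fun j => c • K j) = c • limMKerOf K := by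
  refine limMKerOf_eq_of_tendsto fun x y a b => ?_
  simp only [Pi.smul_apply, smul_eq_mul]
  exact (tendsto_limMKerOf_of_exists h x y a b).const_mul c

/-- [folklore] The constructed limit is additive on convergent families. -/
theorem limMKerOf_add_of_exists_tendsto {K K' : ℕ → MKer D F} (h : ∀ x y a b, ∃ L : ℝ, Tendsto (fun j => K j x y a b) atTop (𝓝 L))
    (h' : ∀ x y a b, ∃ L : ℝ, Tendsto (fun j => K' j x y a b) atTop (𝓝 L)) :
    limMKerOf (fun j => K j + K' j) = limMKerOf K + limMKerOf K' := by
  refine limMKerOf_eq_of_tendsto fun x y a b => ?_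
  simp only [Pi.add_apply]
  exact (tendsto_limMKerOf_of_exists h x y a b).add (tendsto_limMKerOf_of_exists h' x y a b)

/-- [folklore] **CLOSURE OF `Decays` FOR CONVERGENT FAMILIES**: a `j`-uniform bound `Decays (K j) C δ` passes to the constructed limit of an
entrywise convergent family — SAME constant, SAME rate (`le_of_tendsto'`; no all-scales data needed). -/
theorem decays_limMKerOf_of_tendsto {K : ℕ → MKer D F} {C δ : ℝ} (hK : ∀ j, Decays (K j) C δ)
    (h : ∀ x y a b, ∃ L : ℝ, Tendsto (fun j => K j x y a b) atTop (𝓝 L)) : Decays (limMKerOf K) C δ := fun x y a b =>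
  le_of_tendsto' ((tendsto_limMKerOf_of_exists h x y a b).abs) fun j => hK j x y a b

/-- [folklore] CURRENCY BRIDGE: all-scales `Decays` deviations with `θ < 1` (the cell's `hKall` shape) give entrywise convergence. -/
theorem exists_tendsto_of_decays {K : ℕ → MKer D F} {c δ θ : ℝ} (hKall : ∀ k j, Decays (K (k + j) - K k) (c * θ ^ k) δ) (hθ1 : θ < 1)
    (x y : Fin D → ℤ) (a b : F) : ∃ L : ℝ, Tendsto (fun j => K j x y a b) atTop (𝓝 L) :=
  ⟨_, tendsto_limMKerOf_of_decays hKall hθ1 x y a b⟩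

/-- [folklore] CURRENCY BRIDGE: `Decays`-rate data to a named limit (`0 ≤ θ < 1`) give entrywise convergence. -/
theorem exists_tendsto_of_decays_rate {K : ℕ → MKer D F} {Kinf : MKer D F} {c δ θ : ℝ} (hrate : ∀ k, Decays (K k - Kinf) (c * θ ^ k) δ)
    (hθ0 : 0 ≤ θ) (hθ1 : θ < 1) (x y : Fin D → ℤ) (a b : F) : ∃ L : ℝ, Tendsto (fun j => K j x y a b) atTop (𝓝 L) :=
  ⟨_, tendsto_of_decays_rate hrate hθ0 hθ1 x y a b⟩

end Closure

/-! ## §3 The perfect resolvent: block covariance (unconditional), reflection invariance and decay (under X1m-K) -/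

section Perfect

variable {d : ℕ} (Lc : ℕ) [NeZero Lc] (sf sm : ℕ → ℝ) (m : ℕ)

/-- **BLOCK COVARIANCE OF THE PERFECT RESOLVENT — 0 HYPOTHESES**: `KPerf Lc sf sm m` is invariant under the `Lc^m`-translations (the binder `hKs`
of every K-generic END at `N := Lc^m`). [our object] -/
theorem shiftK_KPerf (t : Fin (d + 1) → ℤ) :
    shiftK (-(((Lc ^ m : ℕ) : ℤ) • t)) (KPerf (d := d) Lc sf sm m) = KPerf Lc sf sm m :=
  shiftK_limMKerOf_of_invariant fun j => shiftK_unitK_KTot j m (sf j) (sm j) t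

/-- **REFLECTION INVARIANCE OF THE PERFECT RESOLVENT** under X1m-K (entrywise convergence of the unit-rescaled (j, m)-family): for every axis `α`,
`refK (Φ (Lc^m) α) (KPerf Lc sf sm m) = KPerf Lc sf sm m` (the binder `hKr` at `N := Lc^m`). [our object] -/
theorem refK_KPerf
    (hconv : ∀ x y a b, ∃ L : ℝ, Tendsto (fun j => unitK (sf j) (sm j) (KTot (d := d) (Lc ^ (j + m)) (Lc ^ j)) x y a b) atTop (𝓝 L))
    (α : Fin (d + 1)) : refK (Φ (d := d) (Lc ^ m) α) (KPerf (d := d) Lc sf sm m) = KPerf Lc sf sm m :=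
  refK_limMKerOf_of_invariant _ hconv fun j => refK_unitK_KTot j m (sf j) (sm j) α

/-- **DECAY OF THE PERFECT RESOLVENT** under X1m-K and a `j`-uniform `Decays` bound of the unit-rescaled (j, m)-family — same constant and rate
(the binder `hKd` in `Decays` currency). [our object] -/
theorem decays_KPerf {C δ : ℝ} (hK : ∀ j, Decays (unitK (sf j) (sm j) (KTot (d := d) (Lc ^ (j + m)) (Lc ^ j))) C δ)
    (hconv : ∀ x y a b, ∃ L : ℝ, Tendsto (fun j => unitK (sf j) (sm j) (KTot (d := d) (Lc ^ (j + m)) (Lc ^ j)) x y a b) atTop (𝓝 L)) :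
    Decays (KPerf (d := d) Lc sf sm m) C δ :=
  decays_limMKerOf_of_tendsto hK hconv

/-- Reflection invariance of the perfect resolvent, all-scales `Decays` currency (`hKall`, `θ < 1`). [our object] -/
theorem refK_KPerf_of_decays {c δ θ : ℝ}
    (hKall : ∀ k j, Decays (unitK (sf (k + j)) (sm (k + j)) (KTot (d := d) (Lc ^ (k + j + m)) (Lc ^ (k + j))) -
      unitK (sf k) (sm k) (KTot (d := d) (Lc ^ (k + m)) (Lc ^ k))) (c * θ ^ k) δ)
    (hθ1 : θ < 1) (α : Fin (d + 1)) : refK (Φ (d := d) (Lc ^ m) α) (KPerf (d := d) Lc sf sm m) = KPerf Lc sf sm m :=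
  refK_KPerf Lc sf sm m
    (exists_tendsto_of_decays (K := fun j => unitK (sf j) (sm j) (KTot (d := d) (Lc ^ (j + m)) (Lc ^ j))) hKall hθ1) α

/-- Reflection invariance of the perfect resolvent, `Decays`-rate currency to a named limit (`0 ≤ θ < 1`). [our object] -/
theorem refK_KPerf_of_decays_rate {Kinf : MKer (d + 1) (Fib d)} {c δ θ : ℝ}
    (hrate : ∀ k, Decays (unitK (sf k) (sm k) (KTot (d := d) (Lc ^ (k + m)) (Lc ^ k)) - Kinf) (c * θ ^ k) δ)
    (hθ0 : 0 ≤ θ) (hθ1 : θ < 1) (α : Fin (d + 1)) : refK (Φ (d := d) (Lc ^ m) α) (KPerf (d := d) Lc sf sm m) = KPerf Lc sf sm m :=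
  refK_KPerf Lc sf sm m
    (exists_tendsto_of_decays_rate (K := fun j => unitK (sf j) (sm j) (KTot (d := d) (Lc ^ (j + m)) (Lc ^ j))) hrate hθ0 hθ1) α

/-- **THE THREE KERNEL-SIDE BINDERS OF EVERY K-GENERIC REFLECTION END, AT THE PERFECT RESOLVENT** (`K := KPerf Lc sf sm m`, `N := Lc^m`):
`hKd` (∃ decay), `hKs` (block covariance), `hKr` (reflection invariance, every axis) — VERBATIM the hypothesis shapes of
`ResolventReflection.axisReflectionCovariant_flipK_hessKer`, `ChartConjugationEnd.axisReflectionCovariant_flipK_hessKer_conj/_conjT` and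
`ChartConjugationRelativeEnd.axisReflectionCovariant_flipK_hessKer_conj_rel` — from X1m-K + a `j`-uniform `Decays` bound with positive rate. [our object] -/
theorem kernelSide_KPerf {C δ : ℝ} (hδ : 0 < δ) (hK : ∀ j, Decays (unitK (sf j) (sm j) (KTot (d := d) (Lc ^ (j + m)) (Lc ^ j))) C δ)
    (hconv : ∀ x y a b, ∃ L : ℝ, Tendsto (fun j => unitK (sf j) (sm j) (KTot (d := d) (Lc ^ (j + m)) (Lc ^ j)) x y a b) atTop (𝓝 L)) :
    (∃ δ' C' : ℝ, 0 < δ' ∧ 0 ≤ C' ∧ Decays (KPerf (d := d) Lc sf sm m) C' δ') ∧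
    (∀ t : Fin (d + 1) → ℤ, shiftK (-(((Lc ^ m : ℕ) : ℤ) • t)) (KPerf (d := d) Lc sf sm m) = KPerf Lc sf sm m) ∧
    (∀ α : Fin (d + 1), refK (Φ (d := d) (Lc ^ m) α) (KPerf (d := d) Lc sf sm m) = KPerf Lc sf sm m) :=
  ⟨⟨δ, C, hδ, (hK 0).nonneg (Sum.inl 0), decays_KPerf Lc sf sm m hK hconv⟩, shiftK_KPerf Lc sf sm m, refK_KPerf Lc sf sm m hconv⟩

end Perfect

/-! ## §4 Instance: the reflection law of the UNDRESSED perfect one-loop kernel for covariant jet data -/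

section Instance

variable {d : ℕ} (Lc : ℕ) [NeZero Lc] (sf sm : ℕ → ℝ) (m : ℕ)

/-- **THE TYPED REFLECTION LAW (5.7)–(5.8) OF THE UNDRESSED PERFECT ONE-LOOP KERNEL FROM JET COVARIANCE.**  Under X1m-K and a `j`-uniform decay
bound of the unit-rescaled (j, m)-resolvents, for ANY jet datum `J` on blocking `Lc^m` whose stencil family is block-translation (St♭) and reflection
(Sr) covariant and whose second-order family is block-translation (Wt) and reflection (Wr) covariant,
`AxisReflectionCovariant (flipK (hessKer (KPerf …) (vertexOfK (KPerf …) (Lc^m) J.S) J.W))` — an5's `axisReflectionCovariant_flipK_hessKer` with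
ALL THREE kernel-side inputs discharged by §3.  The four jet covariances are HYPOTHESES (binders), never facts. [our object] -/
theorem axisReflectionCovariant_flipK_hessKer_KPerf {C δ : ℝ} (hδ : 0 < δ)
    (hK : ∀ j, Decays (unitK (sf j) (sm j) (KTot (d := d) (Lc ^ (j + m)) (Lc ^ j))) C δ)
    (hconv : ∀ x y a b, ∃ L : ℝ, Tendsto (fun j => unitK (sf j) (sm j) (KTot (d := d) (Lc ^ (j + m)) (Lc ^ j)) x y a b) atTop (𝓝 L))
    (J : JetData d (Lc ^ m))
    (hSt : ∀ (κ' : Fin (d + 1)) (u t : Fin (d + 1) → ℤ),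
      J.S κ' (u + ((Lc ^ m : ℕ) : ℤ) • t) = shiftK (-(((Lc ^ m : ℕ) : ℤ) • t)) (J.S κ' u))
    (hWt : ∀ (μ : Fin (d + 1)) (y : Fin (d + 1) → ℤ) (ν : Fin (d + 1)) (y' t : Fin (d + 1) → ℤ),
      J.W μ (y + t) ν (y' + t) = shiftK (-(((Lc ^ m : ℕ) : ℤ) • t)) (J.W μ y ν y'))
    (hSr : ∀ (α κ' : Fin (d + 1)) (u : Fin (d + 1) → ℤ),
      J.S κ' (bref α κ' u) = reflSign α κ' • refK (Φ (d := d) (Lc ^ m) α) (J.S κ' u))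
    (hWr : ∀ (α μ : Fin (d + 1)) (y : Fin (d + 1) → ℤ) (ν : Fin (d + 1)) (y' : Fin (d + 1) → ℤ),
      J.W μ (bref α μ y) ν (bref α ν y') = (reflSign α μ * reflSign α ν) • refK (Φ (d := d) (Lc ^ m) α) (J.W μ y ν y')) :
    AxisReflectionCovariant
      (flipK (hessKer (KPerf (d := d) Lc sf sm m) (vertexOfK (KPerf (d := d) Lc sf sm m) (Lc ^ m) J.S) J.W)) := by
  obtain ⟨hKd, hKs, hKr⟩ := kernelSide_KPerf Lc sf sm m hδ hK hconv
  exact axisReflectionCovariant_flipK_hessKer hKd hKs hKr J hSt hWt hSr hWr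

end Instance

/-! ## §5 Generic jet-family sockets: block translation and reflection covariance pass to `limStOf` / `limTabOf` and survive the units -/

section Jets

variable {D : ℕ} {F : Type*}

/-- [folklore] **(St♭) PASSES TO THE CONSTRUCTED STENCIL LIMIT — UNCONDITIONALLY**: if every member of a family of stencil tables is
translation covariant (`S j i (u + w) = shiftK v (S j i u)`), so is `limStOf S`. -/
theorem translate_limStOf {ι : Type*} {S : ℕ → ι → (Fin D → ℤ) → MKer D F} {w v : Fin D → ℤ}
    (h : ∀ j i u, S j i (u + w) = shiftK v (S j i u)) (i : ι) (u : Fin D → ℤ) :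
    limStOf S i (u + w) = shiftK v (limStOf S i u) := by
  rw [limStOf_apply, limStOf_apply, shiftK_limMKerOf]
  exact congrArg limMKerOf (funext fun j => h j i u)

/-- [folklore] **(Wt) PASSES TO THE CONSTRUCTED TABLE LIMIT — UNCONDITIONALLY**. -/
theorem translate_limTabOf {ι : Type*} {W : ℕ → ι → (Fin D → ℤ) → ι → (Fin D → ℤ) → MKer D F} {w v : Fin D → ℤ}
    (h : ∀ j μ y ν y', W j μ (y + w) ν (y' + w) = shiftK v (W j μ y ν y')) (μ : ι) (y : Fin D → ℤ) (ν : ι) (y' : Fin D → ℤ) :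
    limTabOf W μ (y + w) ν (y' + w) = shiftK v (limTabOf W μ y ν y') := by
  rw [limTabOf_apply, limTabOf_apply, shiftK_limMKerOf]
  exact congrArg limMKerOf (funext fun j => h j μ y ν y')

/-- [folklore] **(Sr) PASSES TO THE CONSTRUCTED STENCIL LIMIT** of an entrywise CONVERGENT family: `S j i (ρ u) = c • refK Ψ (S j i u)` for every
`j` ⇒ the same for `limStOf S` (generic bond map `ρ`, sign `c`, leg map `Ψ`). -/
theorem reflect_limStOf {ι : Type*} {S : ℕ → ι → (Fin D → ℤ) → MKer D F} (Ψ : LegMap D F) {ρ : (Fin D → ℤ) → (Fin D → ℤ)} {c : ℝ}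
    (hconv : ∀ i u x y a b, ∃ L : ℝ, Tendsto (fun j => S j i u x y a b) atTop (𝓝 L))
    (h : ∀ j i u, S j i (ρ u) = c • refK Ψ (S j i u)) (i : ι) (u : Fin D → ℤ) :
    limStOf S i (ρ u) = c • refK Ψ (limStOf S i u) := by
  rw [limStOf_apply, limStOf_apply, refK_limMKerOf_of_exists_tendsto Ψ (hconv i u),
    ← limMKerOf_smul_of_exists_tendsto c fun x y a b => ?_]
  · exact congrArg limMKerOf (funext fun j => h j i u)
  · simp only [refK_apply]
    obtain ⟨L, hL⟩ := hconv i u (Ψ.r a x) (Ψ.r b y) a b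
    exact ⟨_, hL.const_mul _⟩

/-- [folklore] **(Wr) PASSES TO THE CONSTRUCTED TABLE LIMIT** of an entrywise CONVERGENT family (generic bond maps `ρ μ`, sign `c μ ν`, leg map `Ψ`). -/
theorem reflect_limTabOf {ι : Type*} {W : ℕ → ι → (Fin D → ℤ) → ι → (Fin D → ℤ) → MKer D F} (Ψ : LegMap D F)
    {ρ : ι → (Fin D → ℤ) → (Fin D → ℤ)} {c : ι → ι → ℝ}
    (hconv : ∀ μ y ν y' x z a b, ∃ L : ℝ, Tendsto (fun j => W j μ y ν y' x z a b) atTop (𝓝 L))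
    (h : ∀ j μ y ν y', W j μ (ρ μ y) ν (ρ ν y') = c μ ν • refK Ψ (W j μ y ν y')) (μ : ι) (y : Fin D → ℤ) (ν : ι) (y' : Fin D → ℤ) :
    limTabOf W μ (ρ μ y) ν (ρ ν y') = c μ ν • refK Ψ (limTabOf W μ y ν y') := by
  rw [limTabOf_apply, limTabOf_apply, refK_limMKerOf_of_exists_tendsto Ψ (hconv μ y ν y'),
    ← limMKerOf_smul_of_exists_tendsto (c μ ν) fun x z a b => ?_]
  · exact congrArg limMKerOf (funext fun j => h j μ y ν y')
  · simp only [refK_apply]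
    obtain ⟨L, hL⟩ := hconv μ y ν y' (Ψ.r a x) (Ψ.r b z) a b
    exact ⟨_, hL.const_mul _⟩

end Jets

section Units

variable {d : ℕ}

/-- [folklore] The contragredient change of units commutes with translations (definitional). -/
theorem shiftK_counitK (v : Fin (d + 1) → ℤ) (sf sm : ℝ) (V : MKer (d + 1) (Fib d)) :
    shiftK v (counitK sf sm V) = counitK sf sm (shiftK v V) := rfl
/-- [folklore] The contragredient change of units commutes with leg relabellings. -/
theorem refK_counitK (Ψ : LegMap (d + 1) (Fib d)) (sf sm : ℝ) (V : MKer (d + 1) (Fib d)) :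
    refK Ψ (counitK sf sm V) = counitK sf sm (refK Ψ V) := by
  funext x y a b
  simp only [refK_apply, counitK_apply]
  ring

/-- [folklore] The contragredient change of units is linear: scalars. -/
theorem counitK_smul (sf sm c : ℝ) (V : MKer (d + 1) (Fib d)) : counitK sf sm (c • V) = c • counitK sf sm V := by
  funext x y a b
  simp only [counitK_apply, Pi.smul_apply, smul_eq_mul]
  ring

/-- [folklore] Leg relabellings are linear: scalars. -/
theorem refK_smul (Ψ : LegMap (d + 1) (Fib d)) (c : ℝ) (K : MKer (d + 1) (Fib d)) : refK Ψ (c • K) = c • refK Ψ K := by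
  funext x y a b
  simp only [refK_apply, Pi.smul_apply, smul_eq_mul]
  ring

/-- [folklore] Translations are linear: scalars (definitional). -/
theorem shiftK_smul (v : Fin (d + 1) → ℤ) (c : ℝ) (K : MKer (d + 1) (Fib d)) : shiftK v (c • K) = c • shiftK v K := rfl
/-- [folklore] **(St♭) SURVIVES THE CHANGE OF UNITS `unitS`** (generic translation `w`, shift `v`). -/
theorem unitS_translate {S : Fin (d + 1) → (Fin (d + 1) → ℤ) → MKer (d + 1) (Fib d)} {w v : Fin (d + 1) → ℤ}
    (h : ∀ κ' u, S κ' (u + w) = shiftK v (S κ' u)) (sf sm : ℝ) (κ' : Fin (d + 1)) (u : Fin (d + 1) → ℤ) :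
    unitS sf sm S κ' (u + w) = shiftK v (unitS sf sm S κ' u) := by
  simp only [unitS, h κ' u, shiftK_smul, shiftK_counitK]

/-- [folklore] **(Wt) SURVIVES THE CHANGE OF UNITS `unitW`**. -/
theorem unitW_translate {W : Fin (d + 1) → (Fin (d + 1) → ℤ) → Fin (d + 1) → (Fin (d + 1) → ℤ) → MKer (d + 1) (Fib d)} {w v : Fin (d + 1) → ℤ}
    (h : ∀ μ y ν y', W μ (y + w) ν (y' + w) = shiftK v (W μ y ν y')) (sf sm : ℝ) (μ : Fin (d + 1)) (y : Fin (d + 1) → ℤ) (ν : Fin (d + 1))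
    (y' : Fin (d + 1) → ℤ) : unitW sf sm W μ (y + w) ν (y' + w) = shiftK v (unitW sf sm W μ y ν y') := by
  simp only [unitW, h μ y ν y', shiftK_counitK]

/-- [folklore] **(Sr) SURVIVES THE CHANGE OF UNITS `unitS`** (generic bond map `ρ`, sign `c`, leg map `Ψ`). -/
theorem unitS_reflect {S : Fin (d + 1) → (Fin (d + 1) → ℤ) → MKer (d + 1) (Fib d)} (Ψ : LegMap (d + 1) (Fib d))
    {ρ : (Fin (d + 1) → ℤ) → (Fin (d + 1) → ℤ)} {c : ℝ} (h : ∀ κ' u, S κ' (ρ u) = c • refK Ψ (S κ' u)) (sf sm : ℝ) (κ' : Fin (d + 1))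
    (u : Fin (d + 1) → ℤ) : unitS sf sm S κ' (ρ u) = c • refK Ψ (unitS sf sm S κ' u) := by
  simp only [unitS]
  rw [h κ' u, counitK_smul, refK_smul, refK_counitK]
  exact smul_comm _ _ _

/-- [folklore] **(Wr) SURVIVES THE CHANGE OF UNITS `unitW`** (generic bond maps `ρ μ`, sign `c μ ν`, leg map `Ψ`). -/
theorem unitW_reflect {W : Fin (d + 1) → (Fin (d + 1) → ℤ) → Fin (d + 1) → (Fin (d + 1) → ℤ) → MKer (d + 1) (Fib d)}
    (Ψ : LegMap (d + 1) (Fib d)) {ρ : Fin (d + 1) → (Fin (d + 1) → ℤ) → (Fin (d + 1) → ℤ)} {c : Fin (d + 1) → Fin (d + 1) → ℝ}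
    (h : ∀ μ y ν y', W μ (ρ μ y) ν (ρ ν y') = c μ ν • refK Ψ (W μ y ν y')) (sf sm : ℝ) (μ : Fin (d + 1)) (y : Fin (d + 1) → ℤ)
    (ν : Fin (d + 1)) (y' : Fin (d + 1) → ℤ) : unitW sf sm W μ (ρ μ y) ν (ρ ν y') = c μ ν • refK Ψ (unitW sf sm W μ y ν y') := by
  simp only [unitW]
  rw [h μ y ν y', counitK_smul, refK_counitK]

end Units
end
end Summit.QuantumFields.BalabanUV.Beta.FP.SymmetryK
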